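/-
Copyright (c) 2026 the pub-hodgecm-mathlib formalisation cell (harness21).  Prover seat hodgecm-mathlib-K2Liu-p10 (g3), Track B «K2-LIT»,
#184♮ = hLiu418 = `stmt-HodgeConjecture-24832`; Road Φ of socket #41, organ «Φ4-exact», method «E-det» (LEAD F0P6-plan (g13) 09:54:17Z ∕ 09:57:20Z ∕
10:02:45Z; K2Liu-p12 (g2) interface 10:04:15Z VERBATIM): E4 file 2b-ii — THE VALUE `I(1,1) = −q_v · μ(B(0))` AT A SPLIT PLACE.
THEOREMS ONLY (no `def`, no `instance`, no named-fact hypothesis, no `sorry`).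
-/
import Summits.HodgeConjecture.HodgeConjecture.Theorems.K2LiuSkewLatticeSplitTransport          -- ★ E4 file 2a: `S` at a split place is `M₂(F_v)` read at `w₀`
import Summits.HodgeConjecture.HodgeConjecture.Theorems.K2LiuResidueSingularMatrixCharacterSum   -- ★ E4 file 1: `Σ_{det X = 0} ψ(tr(bX)) = −|k|`
import Summits.HodgeConjecture.HodgeConjecture.Theorems.K2LiuResidueCharacterCosets           -- ★ E4 file 2b-i: coset integrals, `𝓀(F_v)`, `ψ₀`, the two coset computations
import HarnessLib

/-!
# Crux `HLiu418`, Road Φ, organ «Φ4-exact» (E-det), E4 file 2b: `∫_{B(−1) ∩ D(−1)} ψ(−τ tr(β t)) dμ = −q_v · μ(B(0))` AT A SPLIT PLACE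

Cell `hodgecm-mathlib`, crux item hLiu418 = `stmt-HodgeConjecture-24832` (helper lane, count-neutral).  Frame of ★ `K2LiuGoodPlaceWhittakerBound` with
`n = 2` at a place `v` of `F` SPLIT in `E` (`w₀ ∣ v`, `c • w₀ ≠ w₀`); `ψ` of conductor exponent `0`; `β ∈ GL₂` integral with integral inverse and `T`-skew;
`τ = tr_{E⊗F_v ∕ F_v}` on `S`.  By ★ E4 file 2a the `w₀`-coordinates identify `S` with `M₂(F_v)`, `B(a)` with `ϖ^a M₂(𝒪_v)`, `D(m)` with `|det| ≤ |ϖ|^m`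
and `τ(tr(βt))` with `2 tr(bY)`.  Hence `B(−1) ∕ B(0) ≅ M₂(𝓀)` (`κ ↦ ϖ⁻¹ s(κ)`), the integrand is constant on `B(0)`-cosets with value `ψ₀(tr(b̄κ))` for the
non-trivial character `ψ₀(x̄) = ψ(−2ϖ⁻¹x)` of `𝓀`, and `D(−1)` meets exactly the cosets with `det κ = 0`; ★ E4 file 1 (`Σ_{det κ = 0} ψ₀(tr(b̄κ)) = −|𝓀|`)
and ★ `|𝓀| = q_v` give the value.
* `ball_iff_coords`, `det_iff_coords` — `B(a)` and `D(m)` in `w₀`-coordinates;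
* **`setIntegral_ball_inter_det_eq_split`** — THE VALUE, in the bytes of K2Liu-p12 (g2)'s interface (consumed by E5 as `hI11`).
Sources: [KudlaRallis1994, §2]; [Tate1950, §2.2]; [LidlNiederreiter1997, Ch. 5]; [CasselsFrohlichANT1967, Ch. II §10].
HONEST LABEL.  Helper lemmas, count-neutral; `HC_CM` is proved only modulo the 7 printed citations (2 remaining named inputs:
hLiu418 = `stmt-HodgeConjecture-24832`, h413 = `stmt-HodgeConjecture-24833`) until rung 0 closes.
-/

set_option autoImplicit false
set_option linter.dupNamespace false -- the mandated namespace repeats `HodgeConjecture.HodgeConjecture`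

noncomputable section

open scoped Matrix Valued
open NumberField IsDedekindDomain Matrix MeasureTheory
open Literature.NumberTheory.Automorphic Literature.NumberTheory.Automorphic.UnitaryGroup
open Literature.NumberTheory.GelbartRogawski1991.UnitaryDualPair.LocalSplitting
open Summit.HodgeConjecture.HodgeConjecture.Cruxes.HLiu418.K2LiuSkewLatticeSplitTransport
open Summit.HodgeConjecture.HodgeConjecture.Cruxes.HLiu418.K2LiuResidueSingularMatrixCharacterSum
open Summit.HodgeConjecture.HodgeConjecture.Cruxes.HLiu418.K2LiuResidueCharacterCosets

namespace Summit.HodgeConjecture.HodgeConjecture.Cruxes.HLiu418.K2LiuSkewResidueQuadricSplit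

/-! ## 1. The skew lattice at a split place in `w₀`-coordinates -/

section Split

variable (F : Type) [Field F] [NumberField F] (E : Type) [Field E] [NumberField E] [Algebra F E]
  [Algebra.IsQuadraticExtension F E] (c : E ≃ₐ[F] E)
  {δ : E} (hcδ : c δ = -δ) (hδ : δ ≠ 0) {dd : F} (hd : δ * δ = algebraMap F E dd)
  (v : HeightOneSpectrum (𝓞 F)) {T₀ : Matrix (Fin 2) (Fin 2) F} (hT₀ : T₀.IsSymm) (hT₀d : IsUnit T₀.det)
  {π : v.adicCompletion F} (hπ : Valued.v π = WithZero.exp (-1 : ℤ))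
  (w₀ : PlacesOver E v) (hw₀ : c • w₀.1 ≠ w₀.1)

include hw₀ hT₀ hT₀d hπ in
/-- **`B(a)` in coordinates**: a `T`-skew `t` with `w₀`-coordinates `Y` lies in `B(a)` iff `|Y_{ij}| ≤ |ϖ|^a` (★ E4 file 2a `ball_of_skew_of_ball_at`,
`|ι_{w₀}(y)| = |y|`). [cite: CasselsFrohlichANT1967, Ch. II §10] -/
theorem ball_iff_coords
    (hTb : ∀ i j (w : PlacesOver E v), Valued.v (gramS F E v 2 T₀ i j w) ≤ Valued.v (toPlace v w π) ^ (0 : ℤ))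
    (hTib : ∀ i j (w : PlacesOver E v), Valued.v ((gramS F E v 2 T₀)⁻¹ i j w) ≤ Valued.v (toPlace v w π) ^ (0 : ℤ))
    {t : Matrix (Fin 2) (Fin 2) (LocalRing E v)} (ht : (t.map (conjLocal E c v))ᵀ * gramS F E v 2 T₀ + gramS F E v 2 T₀ * t = 0)
    {Y : Matrix (Fin 2) (Fin 2) (v.adicCompletion F)} (hY : ∀ i j, toPlace v w₀ (Y i j) = t i j w₀) (a : ℤ) :
    (∀ i j (w : PlacesOver E v), Valued.v (t i j w) ≤ Valued.v (toPlace v w π) ^ a) ↔ ∀ i j, Valued.v (Y i j) ≤ Valued.v π ^ a := by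
  constructor
  · intro h i j
    have h1 := h i j w₀
    rwa [← hY, valued_toPlace_of_split F E c v w₀ hw₀, valued_toPlace_of_split F E c v w₀ hw₀] at h1
  · intro h
    refine ball_of_skew_of_ball_at F E c v hT₀ hT₀d w₀ hw₀ hπ hTb hTib ht fun i j => ?_
    rw [← hY, valued_toPlace_of_split F E c v w₀ hw₀, valued_toPlace_of_split F E c v w₀ hw₀]; exact h i j

include hw₀ hT₀ hT₀d in
/-- **`D(m)` in coordinates**: a `T`-skew `t` with `w₀`-coordinates `Y` satisfies `|det t|_w ≤ |ϖ|_w^m` at all `w` iff `|det Y| ≤ |ϖ|^m` (★ E4 file 2a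
`det_apply_eq_toPlace_det`, `valued_det_galInv_of_skew`). [cite: KudlaRallis1994, §2] -/
theorem det_iff_coords {t : Matrix (Fin 2) (Fin 2) (LocalRing E v)} (ht : (t.map (conjLocal E c v))ᵀ * gramS F E v 2 T₀ + gramS F E v 2 T₀ * t = 0)
    {Y : Matrix (Fin 2) (Fin 2) (v.adicCompletion F)} (hY : ∀ i j, toPlace v w₀ (Y i j) = t i j w₀) (m : ℤ) :
    (∀ w : PlacesOver E v, Valued.v (t.det w) ≤ Valued.v (toPlace v w π) ^ m) ↔ Valued.v Y.det ≤ Valued.v π ^ m := by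
  have hw0 : Valued.v (t.det w₀) = Valued.v Y.det := by
    rw [det_apply_eq_toPlace_det F E v w₀ hY, valued_toPlace_of_split F E c v w₀ hw₀]
  constructor
  · intro h
    have h1 := h w₀
    rwa [hw0, valued_toPlace_of_split F E c v w₀ hw₀] at h1
  · intro h w
    rcases eq_or_eq_galInv F E c v w₀ hw₀ w with rfl | rfl
    · rw [hw0, valued_toPlace_of_split F E c v w hw₀]; exact h
    · rw [valued_det_galInv_of_skew F E c v hT₀ hT₀d w₀ ht, hw0,
        ← K2LiuLocalRingValuationBalls.valued_toPlace_uniformizer_gal F E v c (PlacesOver.galInv c w₀) w₀ (smul_inv_smul c w₀.1) π,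
        valued_toPlace_of_split F E c v w₀ hw₀]
      exact h

/-! ## 2. THE VALUE at a split place -/

include hcδ hδ hd hT₀ hT₀d hπ hw₀ in
/-- **`I(1,1) = −q_v · μ(B(0))` AT A SPLIT PLACE** (K2Liu-p12 (g2)'s interface (V)-split, consumed by E5 as `hI11`): for `ψ_v` of conductor exponent
`0`, `β ∈ S ∩ GL₂(𝒪)` and `v` split in `E`,
`∫_{B(−1) ∩ D(−1)} ψ_v(−τ tr(β t)) dμ(t) = −q_v · μ(B(0))`.
Proof: `B(−1) = ⨆_{κ ∈ M₂(𝓀)} (R(ϖ⁻¹ s(κ)) + B(0))`, the integrand is `ψ₀(tr(b̄κ))` on the `κ`-coset and `D(−1)` meets it iff `det κ = 0`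
(`setIntegral_eq_sum_cosets`); then ★ E4 file 1 and `|𝓀| = q_v`. [cite: KudlaRallis1994, §2] [cite: Tate1950, §2.2] -/
theorem setIntegral_ball_inter_det_eq_split
    (S : AddSubgroup (Matrix (Fin 2) (Fin 2) (LocalRing E v)))
    (hS : ∀ t, t ∈ S ↔ (t.map (conjLocal E c v))ᵀ * gramS F E v 2 T₀ + gramS F E v 2 T₀ * t = 0)
    [MeasurableSpace S] [BorelSpace S] (μ : Measure S) [μ.IsAddHaarMeasure]
    {ψ : AddChar (v.adicCompletion F) Circle} (hdψ : ψ.HasConductorExp 0)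
    {τ : LocalRing E v → v.adicCompletion F} (hτ : ∀ r, toLocalRing E v (τ r) = r + conjLocal E c v r)
    {β βinv : Matrix (Fin 2) (Fin 2) (LocalRing E v)}
    (hβskew : (β.map (conjLocal E c v))ᵀ * gramS F E v 2 T₀ + gramS F E v 2 T₀ * β = 0) (hββ : β * βinv = 1)
    (hβ : ∀ i j (w : PlacesOver E v), Valued.v (β i j w) ≤ Valued.v (toPlace v w π) ^ (0 : ℤ))
    (hβinv : ∀ i j (w : PlacesOver E v), Valued.v (βinv i j w) ≤ Valued.v (toPlace v w π) ^ (0 : ℤ))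
    (h2v : ∀ w : PlacesOver E v, ValuativeRel.valuation _ (2 : w.1.adicCompletion E) = 1)
    (hTb : ∀ i j (w : PlacesOver E v), Valued.v (gramS F E v 2 T₀ i j w) ≤ Valued.v (toPlace v w π) ^ (0 : ℤ))
    (hTib : ∀ i j (w : PlacesOver E v), Valued.v ((gramS F E v 2 T₀)⁻¹ i j w) ≤ Valued.v (toPlace v w π) ^ (0 : ℤ)) :
    ∫ t in {t : S | ∀ i j (w : PlacesOver E v), Valued.v (t.1 i j w) ≤ Valued.v (toPlace v w π) ^ (-1 : ℤ)} ∩ {t : S | ∀ w : PlacesOver E v, Valued.v (t.1.det w) ≤ Valued.v (toPlace v w π) ^ (-1 : ℤ)}, ((ψ (-τ (Matrix.trace (β * t.1))) : Circle) : ℂ) ∂μ = -(v.residueCard : ℂ) * (μ.real {t : S | ∀ i j (w : PlacesOver E v), Valued.v (t.1 i j w) ≤ Valued.v (toPlace v w π) ^ (0 : ℤ)} : ℂ) := by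
  classical
  obtain ⟨hπ0, hvπ0, hπlt, hπle⟩ := uniformizer_facts F v hπ
  have hpos : 0 < Valued.v π := zero_lt_iff.2 hvπ0
  have hinv1 : 1 ≤ (Valued.v π)⁻¹ := by
    calc (1 : WithZero (Multiplicative ℤ)) = (Valued.v π)⁻¹ * Valued.v π := (inv_mul_cancel₀ hvπ0).symm
      _ ≤ (Valued.v π)⁻¹ * 1 := mul_le_mul' le_rfl hπle
      _ = (Valued.v π)⁻¹ := mul_one _
  -- `2` is a unit of `𝒪_v` (read at the split place `w₀`)
  have h2 : Valued.v (2 : v.adicCompletion F) = 1 := by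
    have hle : Valued.v (2 : w₀.1.adicCompletion E) ≤ Valued.v (1 : w₀.1.adicCompletion E) :=
      (valuation_le_valuation_iff_valued w₀.1 (2 : w₀.1.adicCompletion E) 1).1 (by rw [h2v w₀, map_one])
    have hge : Valued.v (1 : w₀.1.adicCompletion E) ≤ Valued.v (2 : w₀.1.adicCompletion E) :=
      (valuation_le_valuation_iff_valued w₀.1 (1 : w₀.1.adicCompletion E) 2).1 (by rw [h2v w₀, map_one])
    rw [← valued_toPlace_of_split F E c v w₀ hw₀, map_ofNat]
    exact le_antisymm (hle.trans_eq (map_one _)) ((map_one _).symm.trans_le hge)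
  -- the residue field, a section of the residue map, the character `ψ₀`
  haveI : Finite 𝓀[v.adicCompletion F] := finite_residueField F v
  letI : Fintype 𝓀[v.adicCompletion F] := Fintype.ofFinite _
  obtain ⟨sec, hsec⟩ : ∃ sec : 𝓀[v.adicCompletion F] → 𝒪[v.adicCompletion F], ∀ a, IsLocalRing.residue _ (sec a) = a :=
    ⟨Function.surjInv IsLocalRing.residue_surjective, Function.surjInv_eq IsLocalRing.residue_surjective⟩
  obtain ⟨ψ₀, hψ₀1, hψ₀⟩ := exists_addChar_residue F v hπ hdψ h2
  -- skewness of the elements of `S`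
  have hsk : ∀ t : S, (t.1.map (conjLocal E c v))ᵀ * gramS F E v 2 T₀ + gramS F E v 2 T₀ * t.1 = 0 := fun t => (hS t.1).1 t.2
  -- `w₀`-coordinates `b` of `β`: integral with unit determinant
  obtain ⟨b, hb⟩ := exists_coords F E c hcδ hδ hd v w₀ hw₀ β
  obtain ⟨b', hb'⟩ := exists_coords F E c hcδ hδ hd v w₀ hw₀ βinv
  have hbint : ∀ i j, Valued.v (b i j) ≤ 1 := fun i j => by
    have h := hβ i j w₀
    rwa [← hb, valued_toPlace_of_split F E c v w₀ hw₀, valued_toPlace_of_split F E c v w₀ hw₀, zpow_zero] at h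
  have hb'int : ∀ i j, Valued.v (b' i j) ≤ 1 := fun i j => by
    have h := hβinv i j w₀
    rwa [← hb', valued_toPlace_of_split F E c v w₀ hw₀, valued_toPlace_of_split F E c v w₀ hw₀, zpow_zero] at h
  have hdetb : Valued.v b.det = 1 := by
    have h1 : b.det * b'.det = 1 := by
      apply (toPlace v w₀).injective
      rw [map_mul, map_one, ← det_apply_eq_toPlace_det F E v w₀ hb, ← det_apply_eq_toPlace_det F E v w₀ hb', ← Pi.mul_apply, ← Matrix.det_mul, hββ,
        Matrix.det_one, Pi.one_apply]
    have hv : Valued.v b.det * Valued.v b'.det = 1 := by rw [← map_mul, h1, map_one]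
    refine le_antisymm (valued_det_trace_le_one F v hbint hbint).1 ?_
    calc (1 : WithZero (Multiplicative ℤ)) = Valued.v b.det * Valued.v b'.det := hv.symm
      _ ≤ Valued.v b.det * 1 := mul_le_mul' le_rfl (valued_det_trace_le_one F v hb'int hb'int).1
      _ = Valued.v b.det := mul_one _
  set bO : Matrix (Fin 2) (Fin 2) 𝒪[v.adicCompletion F] := Matrix.of fun i j => ⟨b i j, hbint i j⟩ with hbO_def
  have hbO : bO.map (algebraMap 𝒪[v.adicCompletion F] (v.adicCompletion F)) = b := Matrix.ext fun i j => rfl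
  have hunit : IsUnit (bO.map (IsLocalRing.residue 𝒪[v.adicCompletion F])).det := by
    rw [← RingHom.mapMatrix_apply, ← RingHom.map_det, isUnit_iff_ne_zero, Ne, UnitaryLatticeTree.residue_eq_zero_iff_v_lt_one,
      show ((bO.det : 𝒪[v.adicCompletion F]) : v.adicCompletion F) = algebraMap 𝒪[v.adicCompletion F] (v.adicCompletion F) bO.det from rfl, RingHom.map_det, RingHom.mapMatrix_apply, hbO, hdetb]
    exact lt_irrefl _
  -- `B(0)` as a subgroup of `S`
  let H0 : AddSubgroup S :=
    { carrier := {t : S | ∀ i j (w : PlacesOver E v), Valued.v (t.1 i j w) ≤ Valued.v (toPlace v w π) ^ (0 : ℤ)}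
      add_mem' := fun {x y} hx hy i j w => by
        rw [AddSubgroup.coe_add, Matrix.add_apply, Pi.add_apply]
        exact (Valuation.map_add _ _ _).trans (max_le (hx i j w) (hy i j w))
      zero_mem' := fun i j w => by
        rw [AddSubgroup.coe_zero, Matrix.zero_apply, Pi.zero_apply, Valuation.map_zero]; exact zero_le
      neg_mem' := fun {x} hx i j w => by
        rw [AddSubgroup.coe_neg, Matrix.neg_apply, Pi.neg_apply, Valuation.map_neg]; exact hx i j w }
  have hH0 : ∀ {h : S}, h ∈ H0 → ∀ i j (w : PlacesOver E v), Valued.v (h.1 i j w) ≤ Valued.v (toPlace v w π) ^ (0 : ℤ) := fun hh => hh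
  -- integral coordinates of the elements of `B(0)`
  have hcoordsH : ∀ h : S, h ∈ H0 → ∃ H : Matrix (Fin 2) (Fin 2) (v.adicCompletion F), (∀ i j, toPlace v w₀ (H i j) = h.1 i j w₀) ∧ ∀ i j, Valued.v (H i j) ≤ 1 := by
    intro h hh
    obtain ⟨H, hH⟩ := exists_coords F E c hcδ hδ hd v w₀ hw₀ h.1
    refine ⟨H, hH, fun i j => ?_⟩
    have h1 := (ball_iff_coords F E c v hT₀ hT₀d hπ w₀ hw₀ hTb hTib (hsk h) hH 0).1 (hH0 hh) i j
    rwa [zpow_zero] at h1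
  -- the coset representatives `ρ κ = R(ϖ⁻¹ s(κ))`
  let ρ : Matrix (Fin 2) (Fin 2) 𝓀[v.adicCompletion F] → S := fun κ =>
    ⟨(splitIdem F E v w₀ • (π⁻¹ • (Matrix.of fun i j => ((sec (κ i j) : 𝒪[v.adicCompletion F]) : v.adicCompletion F))).map (toLocalRing E v) + splitIdem F E v (PlacesOver.galInv c w₀) • (-((T₀.map (algebraMap F (v.adicCompletion F)))⁻¹ * (π⁻¹ • (Matrix.of fun i j => ((sec (κ i j) : 𝒪[v.adicCompletion F]) : v.adicCompletion F)))ᵀ * T₀.map (algebraMap F (v.adicCompletion F)))).map (toLocalRing E v)), (hS _).2 (skew_section F E c v hT₀ hT₀d w₀ hw₀ (π⁻¹ • (Matrix.of fun i j => ((sec (κ i j) : 𝒪[v.adicCompletion F]) : v.adicCompletion F)))).1⟩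
  have hρ : ∀ κ i j, (ρ κ).1 i j w₀ = toPlace v w₀ ((π⁻¹ • (Matrix.of fun i j => ((sec (κ i j) : 𝒪[v.adicCompletion F]) : v.adicCompletion F))) i j) := fun κ => (skew_section F E c v hT₀ hT₀d w₀ hw₀ (π⁻¹ • (Matrix.of fun i j => ((sec (κ i j) : 𝒪[v.adicCompletion F]) : v.adicCompletion F)))).2
  -- coordinates of `ρ κ + h` and of `ρ κ`
  have hc1 : ∀ κ (h : S) (H : Matrix (Fin 2) (Fin 2) (v.adicCompletion F)), (∀ i j, toPlace v w₀ (H i j) = h.1 i j w₀) →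
      ∀ i j, toPlace v w₀ ((π⁻¹ • (Matrix.of fun i j => ((sec (κ i j) : 𝒪[v.adicCompletion F]) : v.adicCompletion F)) + H) i j) = (ρ κ + h).1 i j w₀ := by
    intro κ h H hH i j
    show toPlace v w₀ ((π⁻¹ • (Matrix.of fun i j => ((sec (κ i j) : 𝒪[v.adicCompletion F]) : v.adicCompletion F))) i j + H i j) = ((ρ κ).1 + h.1) i j w₀
    rw [map_add, Matrix.add_apply, Pi.add_apply, hρ, hH]
  have hc0 : ∀ κ i j, toPlace v w₀ ((π⁻¹ • (Matrix.of fun i j => ((sec (κ i j) : 𝒪[v.adicCompletion F]) : v.adicCompletion F)) + 0) i j) = (ρ κ).1 i j w₀ := fun κ i j => by rw [add_zero]; exact (hρ κ i j).symm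
  have h0int : ∀ i j, Valued.v ((0 : Matrix (Fin 2) (Fin 2) (v.adicCompletion F)) i j) ≤ 1 := fun i j => by rw [Matrix.zero_apply, Valuation.map_zero]; exact zero_le
  -- (A) every coset `ρ κ + B(0)` lies in `B(−1)`
  have hA : ∀ κ (h : S), h ∈ H0 → ρ κ + h ∈ {t : S | ∀ i j (w : PlacesOver E v), Valued.v (t.1 i j w) ≤ Valued.v (toPlace v w π) ^ (-1 : ℤ)} := by
    intro κ h hh
    obtain ⟨H, hH, hHint⟩ := hcoordsH h hh
    refine (ball_iff_coords F E c v hT₀ hT₀d hπ w₀ hw₀ hTb hTib (hsk (ρ κ + h)) (hc1 κ h H hH) (-1)).2 fun i j => ?_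
    rw [Matrix.add_apply, Matrix.smul_apply, smul_eq_mul, _root_.zpow_neg, zpow_one]
    refine (Valuation.map_add _ _ _).trans (max_le ?_ (le_trans (hHint i j) hinv1))
    rw [map_mul, map_inv₀]
    exact (mul_le_mul' le_rfl (sec (κ i j)).2).trans_eq (mul_one _)
  -- (cover) every `t ∈ B(−1)` lies in the coset of `κ = (ϖ Y) mod 𝔪`
  have hcover : ∀ t ∈ {t : S | ∀ i j (w : PlacesOver E v), Valued.v (t.1 i j w) ≤ Valued.v (toPlace v w π) ^ (-1 : ℤ)}, ∃ κ, -ρ κ + t ∈ H0 := by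
    intro t ht
    obtain ⟨Y, hY⟩ := exists_coords F E c hcδ hδ hd v w₀ hw₀ t.1
    have hYb := (ball_iff_coords F E c v hT₀ hT₀d hπ w₀ hw₀ hTb hTib (hsk t) hY (-1)).1 ht
    have hπY : ∀ i j, Valued.v (π * Y i j) ≤ 1 := fun i j => by
      rw [map_mul]
      calc Valued.v π * Valued.v (Y i j) ≤ Valued.v π * Valued.v π ^ (-1 : ℤ) := mul_le_mul' le_rfl (hYb i j)
        _ = 1 := by rw [_root_.zpow_neg, zpow_one, mul_inv_cancel₀ hvπ0]
    refine ⟨Matrix.of fun i j => IsLocalRing.residue 𝒪[v.adicCompletion F] ⟨π * Y i j, hπY i j⟩, ?_⟩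
    refine (ball_iff_coords F E c v hT₀ hT₀d hπ w₀ hw₀ hTb hTib (hsk _)
      (Y := -(π⁻¹ • (Matrix.of fun i j => ((sec ((Matrix.of fun i j => IsLocalRing.residue 𝒪[v.adicCompletion F] ⟨π * Y i j, hπY i j⟩) i j) : 𝒪[v.adicCompletion F]) : v.adicCompletion F))) + Y)
      (fun i j => ?_) 0).2 fun i j => ?_
    · show toPlace v w₀ (-((π⁻¹ • (Matrix.of fun i j => ((sec ((Matrix.of fun i j => IsLocalRing.residue 𝒪[v.adicCompletion F] ⟨π * Y i j, hπY i j⟩) i j) : 𝒪[v.adicCompletion F]) : v.adicCompletion F))) i j) + Y i j) =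
        (-(ρ _).1 + t.1) i j w₀
      rw [map_add, map_neg, Matrix.add_apply, Pi.add_apply, Matrix.neg_apply, Pi.neg_apply, hρ, hY]
    · rw [zpow_zero, Matrix.add_apply, Matrix.neg_apply, Matrix.smul_apply, smul_eq_mul, Matrix.of_apply, Matrix.of_apply,
        show -(π⁻¹ * ((sec (IsLocalRing.residue 𝒪[v.adicCompletion F] ⟨π * Y i j, hπY i j⟩) : 𝒪[v.adicCompletion F]) : v.adicCompletion F)) + Y i j =
          π⁻¹ * (π * Y i j - ((sec (IsLocalRing.residue 𝒪[v.adicCompletion F] ⟨π * Y i j, hπY i j⟩) : 𝒪[v.adicCompletion F]) : v.adicCompletion F)) by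
            rw [mul_sub, ← mul_assoc, inv_mul_cancel₀ hπ0, one_mul]; ring,
        map_mul, map_inv₀, inv_mul_le_iff₀ hpos, mul_one]
      exact (residue_eq_iff F v hπ ⟨π * Y i j, hπY i j⟩ (sec _)).1 (hsec _).symm
  -- (disjoint) distinct `κ` give distinct cosets
  have hdisj : ∀ κ κ', -ρ κ' + ρ κ ∈ H0 → κ = κ' := by
    intro κ κ' hmem
    have hcoords : ∀ i j, toPlace v w₀ ((-(π⁻¹ • (Matrix.of fun i j => ((sec (κ' i j) : 𝒪[v.adicCompletion F]) : v.adicCompletion F))) + π⁻¹ • (Matrix.of fun i j => ((sec (κ i j) : 𝒪[v.adicCompletion F]) : v.adicCompletion F))) i j) = (-ρ κ' + ρ κ).1 i j w₀ := by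
      intro i j
      show toPlace v w₀ (-((π⁻¹ • (Matrix.of fun i j => ((sec (κ' i j) : 𝒪[v.adicCompletion F]) : v.adicCompletion F))) i j) + (π⁻¹ • (Matrix.of fun i j => ((sec (κ i j) : 𝒪[v.adicCompletion F]) : v.adicCompletion F))) i j) = (-(ρ κ').1 + (ρ κ).1) i j w₀
      rw [map_add, map_neg, Matrix.add_apply, Pi.add_apply, Matrix.neg_apply, Pi.neg_apply, hρ, hρ]
    have hint := (ball_iff_coords F E c v hT₀ hT₀d hπ w₀ hw₀ hTb hTib (hsk _) hcoords 0).1 (hH0 hmem)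
    refine Matrix.ext fun i j => ?_
    have h1 := hint i j
    rw [zpow_zero, Matrix.add_apply, Matrix.neg_apply, Matrix.smul_apply, Matrix.smul_apply, smul_eq_mul, smul_eq_mul, Matrix.of_apply, Matrix.of_apply,
      ← mul_neg, ← mul_add, map_mul, map_inv₀, inv_mul_le_iff₀ hpos, mul_one, neg_add_eq_sub] at h1
    rw [← hsec (κ i j), ← hsec (κ' i j)]
    exact (residue_eq_iff F v hπ (sec (κ i j)) (sec (κ' i j))).2 h1
  -- (f) the integrand is constant on cosets, with value `ψ₀(tr(b̄ κ))`
  have hval : ∀ κ (h : S), h ∈ H0 → ((ψ (-τ (Matrix.trace (β * (ρ κ + h).1))) : Circle) : ℂ) = ψ₀ (Matrix.trace (bO.map (IsLocalRing.residue 𝒪[v.adicCompletion F]) * κ)) := by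
    intro κ h hh
    obtain ⟨H, hH, hHint⟩ := hcoordsH h hh
    show ((ψ (-τ (Matrix.trace (β * (ρ κ + h).1))) : Circle) : ℂ) = _
    rw [tau_trace_mul_eq F E c v hT₀ hT₀d w₀ hτ hβskew (hsk _) hb (hc1 κ h H hH), ← hbO]
    exact addChar_trace_coset_eq F v hdψ h2 hψ₀ sec hsec κ bO hHint
  have hf : ∀ κ (h : S), h ∈ H0 →
      ((ψ (-τ (Matrix.trace (β * (ρ κ + h).1))) : Circle) : ℂ) = ((ψ (-τ (Matrix.trace (β * (ρ κ).1))) : Circle) : ℂ) := by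
    intro κ h hh
    rw [hval κ h hh, ← add_zero (ρ κ), hval κ 0 H0.zero_mem]
  -- (D) `D(−1)` meets the `κ`-coset iff `det κ = 0`
  have hDval : ∀ κ (h : S), h ∈ H0 → (ρ κ + h ∈ {t : S | ∀ w : PlacesOver E v, Valued.v (t.1.det w) ≤ Valued.v (toPlace v w π) ^ (-1 : ℤ)} ↔ κ.det = 0) := by
    intro κ h hh
    obtain ⟨H, hH, hHint⟩ := hcoordsH h hh
    rw [Set.mem_setOf_eq, det_iff_coords F E c v hT₀ hT₀d w₀ hw₀ (hsk _) (hc1 κ h H hH) (-1)]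
    exact valued_det_coset_le_iff F v hπ sec hsec κ hHint
  have hD : ∀ κ (h : S), h ∈ H0 → (ρ κ + h ∈ {t : S | ∀ w : PlacesOver E v, Valued.v (t.1.det w) ≤ Valued.v (toPlace v w π) ^ (-1 : ℤ)} ↔ ρ κ ∈ {t : S | ∀ w : PlacesOver E v, Valued.v (t.1.det w) ≤ Valued.v (toPlace v w π) ^ (-1 : ℤ)}) := by
    intro κ h hh
    rw [hDval κ h hh, ← add_zero (ρ κ), hDval κ 0 H0.zero_mem]
  -- the coset decomposition
  rw [setIntegral_eq_sum_cosets μ H0 (K2LiuSkewLatticeShells.measurableSet_ball F E v hπ 2 S 0) (K2LiuSkewLatticeShells.measure_ball_ne_top F E c v hπ 2 S hS μ 0) ρ {t : S | ∀ i j (w : PlacesOver E v), Valued.v (t.1 i j w) ≤ Valued.v (toPlace v w π) ^ (-1 : ℤ)} {t : S | ∀ w : PlacesOver E v, Valued.v (t.1.det w) ≤ Valued.v (toPlace v w π) ^ (-1 : ℤ)} (fun t : S => ((ψ (-τ (Matrix.trace (β * t.1))) : Circle) : ℂ))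
    hcover hA hdisj hf hD, ← Finset.sum_mul]
  show (∑ κ, Set.indicator {t : S | ∀ w : PlacesOver E v, Valued.v (t.1.det w) ≤ Valued.v (toPlace v w π) ^ (-1 : ℤ)} (fun t : S => ((ψ (-τ (Matrix.trace (β * t.1))) : Circle) : ℂ)) (ρ κ)) * ((μ.real {t : S | ∀ i j (w : PlacesOver E v), Valued.v (t.1 i j w) ≤ Valued.v (toPlace v w π) ^ (0 : ℤ)} : ℝ) : ℂ) = _
  congr 1
  rw [show (∑ κ, Set.indicator {t : S | ∀ w : PlacesOver E v, Valued.v (t.1.det w) ≤ Valued.v (toPlace v w π) ^ (-1 : ℤ)} (fun t : S => ((ψ (-τ (Matrix.trace (β * t.1))) : Circle) : ℂ)) (ρ κ)) = ∑ κ : Matrix (Fin 2) (Fin 2) 𝓀[v.adicCompletion F],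
      (if κ.det = 0 then ψ₀ (Matrix.trace (bO.map (IsLocalRing.residue 𝒪[v.adicCompletion F]) * κ)) else 0) from Finset.sum_congr rfl fun κ _ => ?_,
    sum_addChar_trace_mul_of_det_eq_zero hψ₀1 hunit, Fintype.card_eq_nat_card, natCard_residueField_eq F v]
  -- each summand
  rw [Set.indicator_apply]
  by_cases hκ : κ.det = 0
  · rw [if_pos ((add_zero (ρ κ)) ▸ (hDval κ 0 H0.zero_mem).2 hκ :), if_pos hκ, ← add_zero (ρ κ), hval κ 0 H0.zero_mem]
  · rw [if_neg (fun hmem => hκ ((hDval κ 0 H0.zero_mem).1 ((add_zero (ρ κ)).symm ▸ hmem))), if_neg hκ]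

end Split

end Summit.HodgeConjecture.HodgeConjecture.Cruxes.HLiu418.K2LiuSkewResidueQuadricSplit

end
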